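import Mathlib
import HarnessLib
import HarnessLib.Audit
import Summits.HodgeConjecture.HodgeConjecture.Statement
import Literature.AlgebraicGeometry.HodgeTheory.AlgebraicClassesCup
import Literature.AlgebraicGeometry.HodgeTheory.LefschetzOneOne
import Literature.AlgebraicGeometry.Motives.EllAdicEtaleRational
import Literature.AlgebraicGeometry.Motives.BaseChange
import Literature.NumberTheory.GaloisRepresentations.GaloisRep

/-!
Route: EndoscopicBallQuotient

CLOSED (retired) 2026-08-15T13:48:13Z by operator:999:1257524 — reason: not-a-thesis: assembly does not conclude the sub-problem Statement — note: D-0027 §2.1 audit (human 2026-08-15: routes that do not decide the summit are removed): the assembly concludes `MiddleDegreeHodgeLowDim`, not the sub-problem statement; a NEW conforming route may be opened from the same idea (generated `closes : … → _root_.HodgeConjecture`).. The file is kept as the record of this route; refuted decls are indexed as negative knowledge (`ledger negatives`).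

THESIS X (realises idea card HodgeConjecture/HodgeConjecture/endoscopic-middle-third-ball-quotients;
PARTIAL-FAMILY route).
Family: smooth projective complex varieties X of EVEN dimension p = 2n carrying a
`UnitaryBallQuotientDatum p X` — X(ℂ) ≅ Γ\𝔹^p with Γ a neat congruence subgroup of U(V), V an
anisotropic hermitian space of signature (p,1) at one real place and definite at the others over a
CM extension E/F (Bergeron–Millson–Moeglin arXiv:1306.1515 §1.1: compact connected Shimura varieties
of simple unitary type).
X := MiddleHodgeInThetaSpan: for n = m+1 ≥ 2 and every such X there is a rational (1,1)-class h
(intended: the Kähler / canonical class) such that every RATIONAL Hodge (n,n)-class on X lies in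
  ThetaSpan_n(D,h) := SC^n ⊔ span_ℂ{ Z ∪ b : Z ∈ SC^{n-1}, b rational (1,1) } ⊔ span_ℂ{ a ∪ h : a
rational Hodge (n-1,n-1) },
SC^k = specialCycleClasses D k = span of the classes of special cycles (sub-ball quotients) of
codimension k. This is the shape of BMM Thm 4 (a = b: SC^{2(a-1)} · SH^{1,1} ↠ H^{a×1,a×1})
transported INTO the middle degree that BMM Cor. 2 (n ∉ ]p/3, 2p/3[) always excludes when p = 2n,
for rational classes only.
It suffices: X → ThetaSpanAlgebraic (glue: pure linear algebra) → LowerDegreeHodge (Lefschetz (1,1)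
+ BMM Cor. 2 at p = 6, k = 2) → CupProductAlgebraic (Voisin II Prop. 9.20) → SpecialClassesAlgebraic
→ Literature.AlgebraicGeometry.HodgeTheory.lefschetzOneOne_rational → MiddleDegreeHodgeLowDim = the
Hodge conjecture in the middle degree for every member of dimension 2, 4, 6; with BMM Cor. 2 + hard
Lefschetz this is the FULL Hodge conjecture for compact arithmetic ball-quotient fourfolds and
sixfolds of simple unitary type (p = 4: degrees 2,6 Lefschetz/dual, 4 = X; p = 6: degrees 4,8 BMM k
= 2 ≤ p/3, 6 = X). The Assembly ends in this named sub-family statement, NOT in `HodgeConjecture`: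
no honest bridge from one family to all varieties exists (PROBLEMS.md §3 lists family theses for
this summit); the route's value is a new infinite family + the Tate twin + a falsifiable prediction
of non-geodesic cycles.
Lean: every item signature elaborates in folder/Sketch.lean (lean check rc 0, 0 sorries, 2026-08-15;
`assembly_holds` and `thetaSpanAlgebraic_holds` PROVE the assembly and the glue are pure logic)
modulo exactly two REQUESTED definitions, `UnitaryBallQuotientDatum (p : ℕ) (X : SchemeOver ℂ) :
Type` and `specialCycleClasses (D) (k) : Submodule ℂ (complexBetti X (2*k))` (definition items
filed): items mentioning them open BLOCKED and are to be restated verbatim (`ledger route edit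
--restate`) when the definitions land; CupProductAlgebraic is live now. One-line Lean of X: `∀ m X
(D : UnitaryBallQuotientDatum (2*(m+1)) X), 1 ≤ m → IsSmoothProjective (2*(m+1)) X → ∃ h :
complexBetti X (2*1), IsRationalClass h ∧ IsOfHodgeType _ X (2*1) 1 1 h ∧ ∀ c : complexBetti X
(2*(m+1)), IsRationalClass c → IsOfHodgeType _ X _ (m+1) (m+1) c → c ∈ specialCycleClasses D (m+1) ⊔
span{a ∪ b | a ∈ specialCycleClasses D m, b rational (1,1)} ⊔ span{a ∪ h | a rational Hodge (m,m)}`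
(full term in the item).

Rationale: WHY THIS LINE (import: automorphic forms / endoscopy / theta correspondence → algebraic cycles). On
a compact ball quotient a Hodge class IS a (sum of) cohomological automorphic representations π =
A_{a,b} ⊗ π_f (Matsushima + Vogan–Zuckerman), and BMM arXiv:1306.1515 (Acta 2016) prove HC and Tate
for S = Γ\𝔹^p in every degree n ∉ ]p/3,2p/3[ by showing that there every π is a theta lift whose
Kudla–Millson classes are special cycles times (1,1)-classes (Thm 4, Cor 2–3; steps 1–3 =
Kudla–Millson doi:10.1007/BF02699880, Fock cocycles, special = general theta lift). READ this
session (pp.1–8, 32, 53–54): the range enters ONLY in Prop. 80(2) ('3a > m+|p|' forces the big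
SL_2-block's μ to be a character) — an ENDOSCOPIC, not analytic, wall — and HC needs only RATIONAL
classes. In the middle degree of EVEN-dimensional quotients (p = 2n, a = 1: the excluded case for
every n) primitive classes are discrete series, every parameter is generic, and a rational Hodge /
Tate class should force a conjugate-self-dual character constituent χ₀ of middle type (Galois side:
KSZ arXiv:2110.05381, Mok arXiv:1206.0882, KMSW arXiv:1409.3731), whence a pole of L^S(s,χ₀⁻¹×π) at
s = 1 (Jacquet–Shalika), theta from U(n,n) by the Kudla–Rallis/Ichino/GQT criterion
(arXiv:1207.4709; archimedean: A. Paul doi:10.1006/jfan.1998.3330), and BMM steps 1–3 give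
SC^{n-1}·H^{1,1} mod L (H^{1,1} rational for p > 2, Cor. 62). What theta cannot reach are
GL_2/GL_3-CAP packets (a ≥ 2, odd p or off-middle degrees): there HC predicts NON-geodesic cycles
('higher Blasius–Rogawski classes', zbl:0828.14012; endoscopic cohomology of U(n,1) exists:
Marshall–Shin arXiv:1804.05047). No probabilistic/PDE reformulation applies; the spectral
(trace-formula) side IS the reformulation.
RANKED CRUXES. #2 MiddleHodgeInThetaSpan (typed; = B1∘B2 of the card; the heart). #3
MiddleTateClassesAlgebraic (typed on the étale side of a number-field model, no comparison iso
needed: Tate in degree 2n for the family — the card's 'conditional on nothing new' deliverable and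
the first test of the mechanism; not an antecedent of the Assembly). #4 RationalHodgeTateTypeSupport
(B2, informal until a Hecke-isotypic decomposition exists in Lean: rational Hodge ⇒ character
constituent / Tate type; Hodge⇒absolute-Hodge-hard, the refuter's target). #5
HigherBlasiusRogawskiClass (typed existence at p = 5, k = 2: a rational (2,2)-class outside SC² +
Div·Div; either answer informative). Support: ThetaSpanAlgebraic (glue, proved pure-logic in
Sketch), LowerDegreeHodge (Lefschetz + BMM Cor 2 instance, known), CupProductAlgebraic (Voisin II
9.20, known, LIVE), SpecialClassesAlgebraic (definitional). Target MiddleDegreeHodgeLowDim; Assembly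
proved pure logic in Sketch (`assembly_holds`).
TYPING STATUS / FIRST OBSTACLE MADE EXPLICIT: the library has honest singular cohomology, Hodge
types, algebraicClasses, cup products, honest ℓ-adic Galois representations, but NO Shimura
varieties: two definitions are requested (UnitaryBallQuotientDatum, specialCycleClasses; plus
heckeIsotypicComponent for #4) and a cite item for BMM Cor. 2/Thm 4 as named facts; 8 of 9 typed
items open BLOCKED on exactly those names and need only `--restate` with the same text when they
land (signatures verified against stand-ins, Sketch.lean rc 0).
KILL CRITERIA. (i) A. Paul's archimedean theta for (U(4,1),U(2,2)) does not pair DS_(2,2) with the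
KM vector, or ε-dichotomy sends the lift to the definite tower → #2,#3 die at n = 2 (close refuted
or pivot to 'true but empty'). (ii) A rational (n,n)-class in a stable tempered M[π_f] (refuter
exhibits Hodge-not-Tate) → #2 and #4 refuted; the route closes with a counterexample CANDIDATE to
Hodge-or-Tate worth its own negative route. (iii) #5 refuted (¬: all rational (2,2)-classes on
compact U(5,1) quotients lie in SC²+Div·Div) is GOOD news: extend the target to p = 5.
DELIBERATELY NOT DECOMPOSED: the split of #2 into (#3-type Betti statement) + #4 + glue (needs the
comparison/isotypic vocabulary); B0 bookkeeping (A_q packets, SL_2-types); B4 = cycles for CAP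
classes (dihedral μ: Res unitary groups over the splitting field / Flicker–Rallis periods;
non-dihedral: geometric endoscopic transfer, Deligne–Mostow moduli; BZSV 'distinguished'
organisation carried over from superseded card hodge-equals-distinguished-shimura); p = 2n ≥ 8
(other middle-third degrees are a ≥ 2 territory); non-compact (Picard modular, F = ℚ) quotients.
NOVELTY and BARRIERS: see the dedicated sections (searched: zbMATH ×14 queries + lit citing
arXiv:1306.1515 (31) today; card audit new-combination by refuter-novelty-audit-7-0).

Novelty: Nearest prior art: Bergeron–Millson–Moeglin arXiv:1306.1515 = doi:10.1007/s11511-016-0136-2 (Acta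
Math. 216 (2016); READ pp.1–8, 32, 53–54 this session: Cor. 2 = HC for compact U(p,1) quotients in
degrees n ∉ ]p/3,2p/3[, which excludes the middle degree of every even-dimensional quotient; Thm 4
(a = b): SC^{2(a-1)}·SH^{1,1} ↠ H^{a×1,a×1}; the range is used only in Prop. 80(2) '3a > m+|p|';
p.32: for p = 2 the theta/endoscopic part of H^{1,1} is rational, [BR] = Blasius–Rogawski
zbl:0828.14012); BMM orthogonal arXiv:1110.3049 (2.6–2.7: non-theta classes beyond the range);
Marshall–Shin arXiv:1804.05047 (endoscopic cohomology growth in U(n,1) towers: the CAP classes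
exist); Ichino–Prasanna arXiv:1806.10563 (Hodge classes on quaternionic products via JL — different
family and mechanism); Ramakrishnan math/0310162 (Tate/Hodge in the middle degree of Hilbert modular
fourfolds by period relations). Searched 2026-08-15: zbMATH ×14 queries ('Hodge conjecture
arithmetic quotients complex balls' → BMM only; 'Tate conjecture unitary Shimura varieties' → BMM,
RSZ arXiv:1710.06962, Caraiani–Scholze arXiv:1909.01898, Grobner–Harris–Lin; 'Picard modular
varieties Tate conjecture cohomology' → Virdol doi:10.1016/j.jnt.2007.12.005, Bajpai–Cavicchi
arXiv:2203.16435; 'special cycles unitary Shimura varieties cohomology span', 'cohomological theta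
correspondence U(n,1) middle degree', 'non-tempered cohomology classes ball quotients endoscopic' →
nothing), `lit citing arXiv:1306.1515` (31 descend  [refs: 10.1007/s11511-016-0136-2, 10.1016/j.jnt.2007.12.005, 1306.1515, 1110.3049, 1804.05047, 1806.10563, 1710.06962, 1909.01898, 2203.16435, 1812.01150, 2402.12159, doi:10.1007/s11511-016-0136-2, doi:10.1016/j.jnt.2007.12.005]

Barriers (technique_class: automorphic-forms, theta-lifts, endoscopy, special-cycles): technique_class: automorphic-forms, theta-lifts, endoscopy, special-cycles
- Literature.Barriers.HodgeConjecture.Weil1977_exceptionalHodgeClasses and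
Literature.Barriers.HodgeConjecture.Mumford1968_simpleFourfold_exceptionalHodgeClasses (Hodge ring
not generated by divisor classes): APPLIES to the SHAPE of ThetaSpan (it uses products with divisor
classes) — evaded because ThetaSpan also contains the special cycles of every codimension (sub-ball
quotients, not divisor monomials) and BMM Thm 4 PROVES this shape spans in its range; where spanning
should fail (CAP packets) the route does not assume it but files the failure itself as the crux
HigherBlasiusRogawskiClass.
- Literature.Barriers.HodgeConjecture.hodgeClassesAreAbsoluteFor_abelianVariety and
Literature.Barriers.HodgeConjecture.Andre1996_hodgeClassesOnAbelianVarieties_motivated: abelian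
varieties only; compact ball quotients are not known to have motives of abelian type, so neither
helps nor blocks; the absolute-Hodge-type content (rational Hodge ⇒ Tate-type support) is ISOLATED
as crux RationalHodgeTateTypeSupport and flagged as the refuter's target, never assumed.
- Literature.Barriers.HodgeConjecture.Serre1964_conjugateVarieties_notHomeomorphic and
Literature.Barriers.HodgeConjecture.Charles2009_conjugateVarieties_cohomologyAlgebrasNotIso: no
Betti class is transported along Aut(ℂ); the Tate crux MiddleTateClassesAlgebraic is stated purely
on the étale side of a number-field model X₀/K (Galois action on H_et(X₀ ⊗ K̄,

Novelty grade: new-combination — ROUTE REVIEW + grade (refuter f6cf7693, 2026-08-15). Grade inherits the card audit (new-combination) and the planner's documented 14 zbMATH queries + lit citing arXiv:1306.1515; my own search: 1 local hybrid query (only Kondō/ACT/Dolgachev–Kondō moduli-ball-quotient hits, nothing on the mechanism);  (refuter refuter-rreview-route-HodgeConjecture-En-f6cf7693-0, 2026-08-15T12:39:58Z; prior: arXiv:1306.1515, doi:10.1007/s11511-016-0136-2, arXiv:1110.3049, arXiv:1804.05047, zbl:0828.14012, arXiv:2110.05381, arXiv:1207.4709)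

History (route lifecycle, newest last):
- 2026-08-15T13:48:13Z · CLOSED retired — not-a-thesis: assembly does not conclude the sub-problem Statement (operator:999:1257524)

sub-problem: HodgeConjecture · status: closed(retired) · opened planner-plancard-HodgeConjecture-HodgeConject-3ae64d18-0 2026-08-15T11:03:05Z · rev 2 · ledger route-HodgeConjecture-EndoscopicBallQuotient
GENERATED by the gate from the ledger (D-0016/17). Provers cite these decls: `theorem foo : Summit.HodgeConjecture.HodgeConjecture.Theses.EndoscopicBallQuotient.<Decl> := …` in Summits/HodgeConjecture/HodgeConjecture/Theorems/<Name>.lean.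
-/

namespace Summit.HodgeConjecture.HodgeConjecture.Theses.EndoscopicBallQuotient

open scoped BigOperators Topology Manifold Classical MeasureTheory ProbabilityTheory Matrix InnerProductSpace ComplexConjugate ContinuousMap
open Filter Set Function TopologicalSpace MeasureTheory

attribute [summit_statement] _root_.HodgeConjecture

-- TODO item stmt-HodgeConjecture-2317 · target · rank 0 · closed · moot by None · by planner — BLOCKED: missing decl(s) UnitaryBallQuotientDatum; restate via `ledger route edit` once they land:
--   def MiddleDegreeHodgeLowDim : Prop := ∀ (m : ℕ) (X : Literature.AlgebraicGeometry.Motives.SchemeOver ℂ), m ≤ 2 → Literature.AlgebraicGeometry.Motives.IsSmoothProjective (2 * (m + 1)) X → Nonempty (UnitaryBallQuotientDatum (2 * (m + 1)) X) → ∀ c : Literature.AlgebraicGeometry.HodgeTheory.complexBetti X (2 * (m + 1)), Literature.Algebraic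

-- TODO item stmt-HodgeConjecture-2319 · crux · rank 2 · closed · moot by None · by planner — BLOCKED: missing decl(s) UnitaryBallQuotientDatum, specialCycleClasses; restate via `ledger route edit` once they land:
--   def MiddleHodgeInThetaSpan : Prop := ∀ (m : ℕ) (X : Literature.AlgebraicGeometry.Motives.SchemeOver ℂ) (D : UnitaryBallQuotientDatum (2 * (m + 1)) X), 1 ≤ m → Literature.AlgebraicGeometry.Motives.IsSmoothProjective (2 * (m + 1)) X → ∃ h : Literature.AlgebraicGeometry.HodgeTheory.complexBetti X (2 * 1), Literature.AlgebraicGeometry.Hodg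

-- TODO item stmt-HodgeConjecture-2320 · crux · rank 3 · closed · moot by None · by planner — BLOCKED: missing decl(s) UnitaryBallQuotientDatum; restate via `ledger route edit` once they land:
--   def MiddleTateClassesAlgebraic : Prop := ∀ (m : ℕ) (K : Type) [Field K] [NumberField K] (σ : K →+* ℂ) (X₀ : Literature.AlgebraicGeometry.Motives.SchemeOver K) (ℓ : ℕ) [Fact ℓ.Prime], 1 ≤ m → Literature.AlgebraicGeometry.Motives.IsSmoothProjective (2 * (m + 1)) X₀ → Nonempty (UnitaryBallQuotientDatum (2 * (m + 1)) ((Literature.AlgebraicGeom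

-- item stmt-HodgeConjecture-2407 · crux · rank 4 · closed · moot by None · by planner — informal only, no Lean statement yet:
--   [crux] (rank 4; card B2; INFORMAL until a Hecke-isotypic decomposition of H^i(X(C),C) for a
--   UnitaryBallQuotientDatum exists in Lean - definition `heckeIsotypicComponent` requested; decl name
--   RationalHodgeTateTypeSupport reserved.) Statement: let X (datum D, dimension p = 2n >= 4, level K
--   neat) be a compact unitary ball quotient and pi_f an irreducible representation of U(V)(A_{F,f})
--   occurring in H^{2n}(X(C), C); write M[pi_f] for the sum of the pi_f'-isotypic components over the
--   Aut(C)-conjugates pi_f' of pi_f (a Q-sub-Hodge structure, cut out by Hecke correspondences: BMM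
--   arXiv:1306.1515 Cor.

-- TODO item stmt-HodgeConjecture-2321 · crux · rank 5 · closed · moot by None · by planner — BLOCKED: missing decl(s) UnitaryBallQuotientDatum, specialCycleClasses; restate via `ledger route edit` once they land:
--   def HigherBlasiusRogawskiClass : Prop := ∃ (X : Literature.AlgebraicGeometry.Motives.SchemeOver ℂ) (D : UnitaryBallQuotientDatum 5 X) (c : Literature.AlgebraicGeometry.HodgeTheory.complexBetti X (2 * (1 + 1))), Literature.AlgebraicGeometry.Motives.IsSmoothProjective 5 X ∧ Literature.AlgebraicGeometry.HodgeTheory.IsRationalClass c ∧ Literat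

-- TODO item stmt-HodgeConjecture-2322 · support · rank 9 · closed · moot by None · by planner — BLOCKED: missing decl(s) UnitaryBallQuotientDatum, specialCycleClasses; restate via `ledger route edit` once they land:
--   def ThetaSpanAlgebraic : Prop := ∀ (m : ℕ) (X : Literature.AlgebraicGeometry.Motives.SchemeOver ℂ), 1 ≤ m → m ≤ 2 → Literature.AlgebraicGeometry.Motives.IsSmoothProjective (2 * (m + 1)) X → ∀ (D : UnitaryBallQuotientDatum (2 * (m + 1)) X), (∀ a : Literature.AlgebraicGeometry.HodgeTheory.complexBetti X (2 * m), Literature.AlgebraicG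

-- TODO item stmt-HodgeConjecture-2323 · support · rank 9 · closed · moot by None · by planner — BLOCKED: missing decl(s) UnitaryBallQuotientDatum; restate via `ledger route edit` once they land:
--   def LowerDegreeHodge : Prop := Literature.AlgebraicGeometry.HodgeTheory.lefschetzOneOne_rational → ∀ (m : ℕ) (X : Literature.AlgebraicGeometry.Motives.SchemeOver ℂ), 1 ≤ m → m ≤ 2 → Literature.AlgebraicGeometry.Motives.IsSmoothProjective (2 * (m + 1)) X → Nonempty (UnitaryBallQuotientDatum (2 * (m + 1)) X) → ∀ a : Literature.Alge

/-- item stmt-HodgeConjecture-2324 · support · rank 9 · closed · moot by None · by planner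
sources: VoisinHodgeII2003 Prop. 9.20, Prop. 9.21 (i), Lemma 9.22, Fulton1998 sec. 19.2 and sec. 11.4 (moving lemma)
[support] KNOWN (Voisin II Prop. 9.20; Fulton 19.2): N^l H^2l u N^k H^2k <= N^(l+k) H^2(l+k) for X
smooth projective over C, i.e. cup products of algebraic classes are algebraic. LIVE NOW over
existing vocabulary and claimable by any idle prover: the tree already has the topological half and
the reduction `Literature.AlgebraicGeometry.HodgeTheory.cupProduct_mem_algebraicClasses_of_moving`
(AlgebraicClassesCup.lean); what remains is its hypothesis `hmove` = purity of H_Z + Chow's moving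
lemma (Fulton 11.4). Serves every Hodge route that multiplies cycles; here it feeds
ThetaSpanAlgebraic. -/
@[route_item "route-HodgeConjecture-EndoscopicBallQuotient"]
def CupProductAlgebraic : Prop :=
  ∀ ⦃n : ℕ⦄ ⦃X : Literature.AlgebraicGeometry.Motives.SchemeOver ℂ⦄, Literature.AlgebraicGeometry.Motives.IsSmoothProjective n X → ∀ (l k : ℕ) (a : Literature.AlgebraicGeometry.HodgeTheory.complexBetti X (2 * l)) (b : Literature.AlgebraicGeometry.HodgeTheory.complexBetti X (2 * k)), a ∈ Literature.AlgebraicGeometry.HodgeTheory.algebraicClasses X l → b ∈ Literature.AlgebraicGeometry.HodgeTheory.algebraicClasses X k → Literature.AlgebraicTopology.SingularHomology.cupProduct (Literature.AlgebraicGeometry.HodgeTheory.two_mul_add_two_mul l k) a b ∈ Literature.AlgebraicGeometry.HodgeTheory.algebraicClasses X (l + k)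

-- TODO item stmt-HodgeConjecture-2325 · support · rank 9 · closed · moot by None · by planner — BLOCKED: missing decl(s) UnitaryBallQuotientDatum, specialCycleClasses; restate via `ledger route edit` once they land:
--   def SpecialClassesAlgebraic : Prop := ∀ (p : ℕ) (X : Literature.AlgebraicGeometry.Motives.SchemeOver ℂ) (D : UnitaryBallQuotientDatum p X) (k : ℕ), specialCycleClasses D k ≤ Literature.AlgebraicGeometry.HodgeTheory.algebraicClasses X k

-- TODO item stmt-HodgeConjecture-2318 · assembly · rank 1 · closed · moot by None · by planner — BLOCKED: missing decl(s) LowerDegreeHodge, MiddleDegreeHodgeLowDim, MiddleHodgeInThetaSpan, SpecialClassesAlgebraic, ThetaSpanAlgebraic; restate via `ledger route edit` once they land: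
--   def Assembly : Prop := MiddleHodgeInThetaSpan → ThetaSpanAlgebraic → LowerDegreeHodge → CupProductAlgebraic → SpecialClassesAlgebraic → Literature.AlgebraicGeometry.HodgeTheory.lefschetzOneOne_rational → MiddleDegreeHodgeLowDim

end Summit.HodgeConjecture.HodgeConjecture.Theses.EndoscopicBallQuotient
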